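import Literature.AnabelianGeometry.EtaleTheta.Discharge.Sec3Prop34CnstOfRlfRTreeModelData
import Literature.AnabelianGeometry.EtaleTheta.Discharge.Sec3Prop34CnstOfRlfRChainModel
import Literature.AnabelianGeometry.EtaleTheta.Discharge.Sec3Prop34CnstOfRlfR
import Literature.AnabelianGeometry.EtaleTheta.PiNNRatPrimeCoordinates
import Literature.AnabelianGeometry.EtaleTheta.TemperedFrobenioidCnst
import Literature.AnabelianGeometry.EtaleTheta.RealifiedDivisorMonoidsOfRlfR
import Literature.AnabelianGeometry.EtaleTheta.FrdIVocabulary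
import HarnessLib

/-!
# [EtTh] Prop 3.4 (ii) / Def 3.6 (i), `Λ = ℝ`, at TREE-LIKE tempered coverings — the TREE MODEL, part 3: the
# `Λ = ℝ` effective-locus clause `hE` FAILS at the tree data (an effective, non-constant, positive harmonic element of
# `ℝ·Φ₀^birat`) although the law (L), Prop. 3.4 and `Prop34Cnst₀` hold — the law (L) does not decide `hE`

NEGATIVE MODEL companion in the series `Discharge/Sec3*.lean`, cell abc-iut, sub-DAG `plan/L2/SUBDAG-EtTh-Thm37.md`,
row «EtTh:Thm3.7(iii)/L10-R», GAP-LEDGER G-w5d130-1; part 1 `Sec3Prop34CnstOfRlfRTreeModel.lean` (the tree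
`T₃ = ℤ × ℕ`, the integer minimum principle, the golden harmonic pair `hA`, `hB`), part 2
`Sec3Prop34CnstOfRlfRTreeModelData.lean` (the Def. 3.3 (iii) data `dm` with the law (L); `Prop34`, `Prop34Cnst₀`).  S. Mochizuki, *The étale theta function …*, Publ. RIMS **45** (2009) [EtTh], §3, Def. 3.1 / Prop. 3.2
p.70, Def. 3.3 (iii) p.73, Prop. 3.4 (ii) p.74, Def. 3.6 (i) p.76, Thm. 3.7 (iii) p.79 (PDF pages)
[cite: MochizukiEtTh2009, Prop 3.4 (ii) p.74]; [FrdI] Def. 2.4 (i) p.47 [cite: MochizukiFrdI2008, Def. 2.4(i) p.47].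

CONTENTS.  Over the data `dm` of part 2 (`Prime = V ⊔ V`, `Φ₀ = ∏ ℚ_{≥0}`, `B₀ = (V → ℤ)` with the law (L)
`D φ = (φ, −lap φ)`, `F₀ =` constants; `Prop34` and `Prop34Cnst₀` hold there), with part 1's integer HARMONIC `hA, hB`
(elements `gA, gB ∈ B₀(Y₀)` with cusp-free divisors) the element
`β := ι(div gA) · φ•ι(div gB) ∈ ℝ·Φ₀^birat(Y₀)` (`β_mem`), `φ = (1+√5)/2`, has prime coordinates
`κ_𝔮 · (hA + φ·hB)(v) > 0` at the component `v` and `0` at every cusp (`toAdd_coordGp_β`), so it is EFFECTIVE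
(`β_effective`), while every element of `ℝ·Φ₀^cnst(Y₀)` has EQUAL normalised coordinates at all components
(`exists_const_coord_of_mem_realSpan_cnstGp`, from part 2's `exists_eq_toGp_of_mem_cnstGp`) and `hA + φ·hB` is not
constant: `β ∉ ℝ·Φ₀^cnst(Y₀)` (`β_not_mem`).
Hence **`not_eff`** (`hE` fails at `Y₀`) and **`not_prop34Cnst_ofRlfR`** (`¬ Prop34Cnst (ofRlfR dm hpf) (𝟭 _)`), and
the contrast theorem **`law_L_does_not_decide_hE`**: the chain data and the tree data carry the same law (L), the same
prime types and the same constants, `Prop34Cnst (ofRlfR · ·) (𝟭 _)` holds at the former (p437249) and fails at the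
latter — what decides `hE` is the LIOUVILLE property of the dual graph (recurrence of `ℤ` vs transience of `T₃`),
not the law (L).  VERDICT for the v-next census (item A2 / proposed v2 structure 'DualGraphDivisorData'): recording
the dual graph + (L) in the Def. 3.3 (iii) interface does NOT make `hE` a theorem; `hE` holds exactly at the coverings
whose dual graph is Liouville for the relevant class of functions — all FINITE coverings
(`Sec3Prop34CnstOfRlfRFinite.lean`) and the `Ÿ`-type `ℤ`-coverings (chain model).

DICTIONARY TO THE GENUINE DATA (refereed rigid geometry; docstring-level, NOT kernel-checked; to be double-read by
the referee lanes).  (1) `D₀ = B^temp(X^log)⁰` contains, for every member `Z` of a tempered filter, the universal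
combinatorial covering `Y := Z∞` (p.70–73: "`Z∞^log → X^log` … a `Δ^fil`-covering"), whose dual graph is the
universal covering tree of `Γ_Z`; over the once-punctured Tate curve there are finite étale coverings of `X^log`
with `b₁(Γ_Z) ≥ 2` (e.g. the tame `S₃`-cover branched only at the cusp with node monodromy a transposition: one
rational component with three nodes, genus 3, Mumford; Riemann–Hurwitz `2·3 − 2 = 6·0 + 2·(3 − 1)`), and by
Def. 3.3 (i)(c) every such covering is dominated by some `Z_i∞`, forcing `b₁(Γ_{Z_i}) ≥ 2`: tree-like objects with
branching are unavoidable in `D₀`.  (2) `B₀(Z∞) = Mero(Z∞^log)` (Def. 3.1 (ii), 3.3 (iii)) contains, for EVERY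
integer harmonic `h` on the tree (`Σ_{w∼v} (h(w) − h(v)) = 0`), an analytic unit `u_h` on the generic fibre
`Ω_𝓛 = ℙ¹ ∖ 𝓛` with `ord_C(u_h) = h(C)` at every component: M. van der Put, *Discrete groups, Mumford curves and
theta functions*, Ann. Fac. Sci. Toulouse (6) **1** (1992) 399–438, Thm. 2.1 with Ex. 2.1.1 (b)(c)
(`0 → K^* → O(Ω_𝓛)^* → C(T) → 0`, `C(T)` = currents on the tree `=` `ℤ`-valued measures of total mass `0` on `𝓛`,
with an elementary construction of the unit from the measure); such a unit is a section of `O_{Z∞} ⊗ L`, its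
divisor of zeroes and poles on the formal scheme `Z∞` is supported in the special fibre, i.e. it is log-meromorphic
with cusp-free divisor — the law (L) with `lap h = 0`.  (3) `Φ₀(Z∞)^pf = ∏_{components ⊔ cusps} ℚ_{≥0}` (Prop. 3.2 (i)),
so `Φ₀^rlf(Z∞) = ∏ ℝ_{≥0}` and "effective" = "all prime coordinates `≥ 0`", while `ℝ·Φ₀^cnst(Z∞) = ℝ·div(π) =`
the constant functions on components.  Granting (1)–(3), the element `div(u_{hA}) + φ·div(u_{hB})` of
`ℝ·Φ₀^birat(Z∞)` is effective and not in `ℝ·Φ₀^cnst(Z∞)`: the clause `hE` quantified over ALL `Y : D₀` — as the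
cell's `RealifiedDivisorMonoids.Prop34Cnst (ofRlfR dm hpf) cnst` clause 1 is — would be FALSE at the genuine
Def. 3.3 (iii) data, and print's Thm. 3.7 (iii), first clause, for `Λ = ℝ` ("follows immediately from Proposition
3.4, (ii)", p.80: at `Λ = ℝ`, `O^▷(A)` contains the effective elements of `ℝ·Φ₀^birat`, on which deck transformations
of `Z∞/Z` — trivial on `A^cnst` — act non-trivially) would need its `A` restricted to objects over coverings with a
Liouville dual graph.  Prop. 3.4 (ii) itself (monoid types `ℤ`, `ℚ`) is untouched: it HOLDS at the tree model.
HONEST FRAMING: a MODEL over the cell's abstract interfaces plus a cited dictionary, offered for a referee double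
read (no single-point elimination); nothing here bears on [IUTchIII] Cor. 3.12 or asserts anything about abc;
typed ≠ proved.  Seat abc-iut-w6-d046 (gen 3).
-/

noncomputable section

namespace Literature.AnabelianGeometry.EtaleTheta

open CategoryTheory Opposite Literature.AlgebraicGeometry.Frobenioids NNReal Real

namespace Sec3Prop34CnstOfRlfRTreeModel

/-! ### The element `β := ι(div gA) · φ•ι(div gB) ∈ ℝ·Φ₀^birat(Y₀)`: effective, positive, not constant -/

/-- `β := [ι div gA] · φ • [ι div gB] ∈ (Φ₀^rlf)^gp(Y₀)` — additively `div(gA) + φ·div(gB)`, written in the home of the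
prime coordinates. [cite: MochizukiEtTh2009, Def 3.6 p.76] -/
def β : Algebra.GrothendieckGroup (PiNNRat.isPerfFactorial (ι := I)).Rlf :=
  PiNNRat.ιg (PiNNRat.toGp dA) * IsPerfFactorial.Rlf.realSMul PiNNRat.isPerfFactorial goldenRatio (PiNNRat.ιg (PiNNRat.toGp dB))

/-- `β = ι^gp(div₀ gA) · φ • ι^gp(div₀ gB)` for THE realification datum of `dm`. [cite: MochizukiEtTh2009, Def 3.6 p.76] -/
theorem β_eq_rsmul : β =
    (RealifiedDivisorMonoids.realData dm hpf).toRlfGp Y₀ (dm.div₀ (op Y₀) gA) *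
      (RealifiedDivisorMonoids.realData dm hpf).rsmul Y₀ goldenRatio
        ((RealifiedDivisorMonoids.realData dm hpf).toRlfGp Y₀ (dm.div₀ (op Y₀) gB)) := by
  change β = PiNNRat.ιg (divH gA) * IsPerfFactorial.Rlf.realSMul PiNNRat.isPerfFactorial goldenRatio (PiNNRat.ιg (divH gB))
  rw [divH_gA, divH_gB]
  rfl

/-- `β ∈ ℝ·Φ₀^birat(Y₀) = B₀^ℝ(Y₀)` (product of the generators `1 • ι(div gA)`, `φ • ι(div gB)`).
[cite: MochizukiEtTh2009, Def 3.6 p.76] -/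
theorem β_mem : β ∈ ((RealifiedDivisorMonoids.realData dm hpf).realSpan dm.biratGp).carrier Y₀ := by
  rw [β_eq_rsmul]
  refine Subgroup.mul_mem _
    (Subgroup.subset_closure ⟨1, dm.div₀ (op Y₀) gA, Subgroup.subset_closure ⟨gA, rfl⟩, ?_⟩)
    (Subgroup.subset_closure ⟨_, dm.div₀ (op Y₀) gB, Subgroup.subset_closure ⟨gB, rfl⟩, rfl⟩)
  exact ((RealifiedDivisorMonoids.realData dm hpf).rsmul_one Y₀ _).symm

/-- The real coordinate vector of `β`: `hA + φ·hB` at the components, `0` at the cusps.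
[cite: MochizukiEtTh2009, Def 3.6 p.76] -/
def cβ : I → ℝ := Sum.elim (fun v => (hA v : ℝ) + (hB v : ℝ) * goldenRatio) (fun _ => 0)

/-- `cβ ≥ 0` everywhere (part 1: `hA + φ·hB > 0`). [cite: MochizukiEtTh2009, Prop 3.4 (ii) p.74] -/
theorem cβ_nonneg (i : I) : 0 ≤ cβ i := by
  rcases i with v | v
  · exact (toReal_Psi_pos v).le
  · exact le_rfl

/-- **The prime coordinates of `β`**: `coord_𝔮'(β) = κ · cβ(j(𝔮'))`. [cite: MochizukiFrdI2008, Def. 2.4(i) p.48] -/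
theorem toAdd_coordGp_β (𝔮' : Primes (Perfection M)) (f : RlfAt M 𝔮' ≃* Multiplicative ℝ≥0) {κ : ℝ≥0}
    (hκ : ∀ m : M, Multiplicative.toAdd (PrimeCoord.coord PiNNRat.isPerfFactorial 𝔮' f
      (PiNNRat.isPerfFactorial.toRealification (Perfection.of _ m))) =
        κ * ((Multiplicative.toAdd (m (PiNNRat.jdx 𝔮')) : ℚ≥0) : ℝ≥0)) :
    Multiplicative.toAdd (PrimeCoord.coordGp PiNNRat.isPerfFactorial 𝔮' f β) = (κ : ℝ) * cβ (PiNNRat.jdx 𝔮') := by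
  rw [β, map_mul, toAdd_mul, PrimeCoord.toAdd_coordGp_realSMul]
  change PiNNRat.X 𝔮' f (PiNNRat.toGp dA) + goldenRatio * PiNNRat.X 𝔮' f (PiNNRat.toGp dB) = _
  rw [PiNNRat.X_toGp 𝔮' f hκ, PiNNRat.X_toGp 𝔮' f hκ]
  cases PiNNRat.jdx 𝔮' with
  | inl v => simp only [dA, dB, cβ, Sum.elim_inl]; ring
  | inr v => simp only [dA, dB, cβ, Sum.elim_inr]; push_cast; ring

/-- **`β` is EFFECTIVE**: all its prime coordinates are `≥ 0`, so it is the class of an element of `Φ₀^rlf(Y₀)`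
(`PrimeCoord.exists_eq_of_of_coordGp_nonneg`). [cite: MochizukiEtTh2009, Def 3.6 p.76] -/
theorem β_effective : ∃ y : (PiNNRat.isPerfFactorial (ι := I)).Rlf, β = Algebra.GrothendieckGroup.of y := by
  refine PrimeCoord.exists_eq_of_of_coordGp_nonneg PiNNRat.chart β fun 𝔮' => ?_
  obtain ⟨κ, -, hκ⟩ := PiNNRat.exists_coord_eq_mul_eval 𝔮' (PiNNRat.chart 𝔮')
  rw [toAdd_coordGp_β 𝔮' _ hκ]
  exact mul_nonneg (NNReal.coe_nonneg κ) (cβ_nonneg _)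

/-! ### `ℝ·Φ₀^cnst(Y₀)`: every element has the SAME normalised coordinate at all components (and `0` at the cusps) -/

/-- The coordinate vector of the constant `s`: `s` at every component, `0` at every cusp.
[cite: MochizukiEtTh2009, Def 3.3 p.73] -/
def cv (s : ℝ) : I → ℝ := Sum.elim (fun _ => s) (fun _ => 0)

/-- `cv` is additive. [cite: MochizukiEtTh2009, Def 3.3 p.73] -/
theorem cv_add (s s' : ℝ) (i : I) : cv (s + s') i = cv s i + cv s' i := by
  rcases i with v | v <;> simp [cv]

/-- **Every element of `ℝ·Φ₀^cnst(Y₀)` has prime coordinates `κ_𝔮 · cv(s)` for ONE real `s`** (the same at all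
components, `0` at the cusps). [cite: MochizukiEtTh2009, Def 3.6 p.76] -/
theorem exists_const_coord_of_mem_realSpan_cnstGp {x : Algebra.GrothendieckGroup (PiNNRat.isPerfFactorial (ι := I)).Rlf}
    (hx : x ∈ ((RealifiedDivisorMonoids.realData dm hpf).realSpan dm.cnstGp).carrier Y₀) :
    ∃ s : ℝ, ∀ (𝔮' : Primes (Perfection M)) (κ : ℝ≥0),
      (∀ m : M, Multiplicative.toAdd (PrimeCoord.coord PiNNRat.isPerfFactorial 𝔮' (PiNNRat.chart 𝔮')
        (PiNNRat.isPerfFactorial.toRealification (Perfection.of _ m))) =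
          κ * ((Multiplicative.toAdd (m (PiNNRat.jdx 𝔮')) : ℚ≥0) : ℝ≥0)) →
      Multiplicative.toAdd (PrimeCoord.coordGp PiNNRat.isPerfFactorial 𝔮' (PiNNRat.chart 𝔮') x) =
        (κ : ℝ) * cv s (PiNNRat.jdx 𝔮') := by
  induction hx using Subgroup.closure_induction with
  | mem x hx =>
    obtain ⟨r, c, hc, rfl⟩ := hx
    obtain ⟨n, rfl⟩ := exists_eq_toGp_of_mem_cnstGp hc
    refine ⟨r * n, fun 𝔮' κ hκ => ?_⟩
    change Multiplicative.toAdd (PrimeCoord.coordGp PiNNRat.isPerfFactorial 𝔮' (PiNNRat.chart 𝔮')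
      (IsPerfFactorial.Rlf.realSMul PiNNRat.isPerfFactorial r (PiNNRat.ιg (PiNNRat.toGp _)))) = _
    rw [PrimeCoord.toAdd_coordGp_realSMul]
    change r * PiNNRat.X 𝔮' (PiNNRat.chart 𝔮') (PiNNRat.toGp _) = _
    rw [PiNNRat.X_toGp 𝔮' _ hκ]
    cases PiNNRat.jdx 𝔮' with
    | inl v => simp only [cv, cvZ, Sum.elim_inl]; ring
    | inr v => simp only [cv, cvZ, Sum.elim_inr]; push_cast; ring
  | one =>
    refine ⟨0, fun 𝔮' κ hκ => ?_⟩
    rw [map_one, toAdd_one]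
    cases PiNNRat.jdx 𝔮' with
    | inl v => simp [cv]
    | inr v => simp [cv]
  | mul x y _ _ ihx ihy =>
    obtain ⟨s, hs⟩ := ihx
    obtain ⟨s', hs'⟩ := ihy
    refine ⟨s + s', fun 𝔮' κ hκ => ?_⟩
    rw [map_mul, toAdd_mul, hs 𝔮' κ hκ, hs' 𝔮' κ hκ, cv_add]
    ring
  | inv x _ ih =>
    obtain ⟨s, hs⟩ := ih
    refine ⟨-s, fun 𝔮' κ hκ => ?_⟩
    -- the inverse read in the home of the prime coordinates (same group, syntactically different carrier)
    have e : Multiplicative.toAdd (PrimeCoord.coordGp PiNNRat.isPerfFactorial 𝔮' (PiNNRat.chart 𝔮')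
        (show Algebra.GrothendieckGroup (PiNNRat.isPerfFactorial (ι := I)).Rlf from x)⁻¹) =
        (κ : ℝ) * cv (-s) (PiNNRat.jdx 𝔮') := by
      rw [map_inv, toAdd_inv, hs 𝔮' κ hκ]
      cases PiNNRat.jdx 𝔮' with
      | inl v => simp [cv]
      | inr v => simp [cv]
    exact e

/-- The prime of index `inl v` (the component `v`). [cite: MochizukiFrdI2008, §0 p.12] -/
def 𝔮c (v : V) : Primes (Perfection M) :=
  Primes.congr PiNNRat.eM (PiMonoprime.primeOf (PiNNRat.hP (ι := I)) (Sum.inl v))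

/-- The normalised coordinate of `β` at the component `v` is `(hA + φ·hB)(v)`: if `β` had the coordinates `κ·cv(s)` then
`s = (hA + φ·hB)(v)`. [cite: MochizukiEtTh2009, Prop 3.4 (ii) p.74] -/
theorem eq_of_coord_β_eq (s : ℝ) (v : V)
    (h : ∀ (𝔮' : Primes (Perfection M)) (κ : ℝ≥0),
      (∀ m : M, Multiplicative.toAdd (PrimeCoord.coord PiNNRat.isPerfFactorial 𝔮' (PiNNRat.chart 𝔮')
        (PiNNRat.isPerfFactorial.toRealification (Perfection.of _ m))) =
          κ * ((Multiplicative.toAdd (m (PiNNRat.jdx 𝔮')) : ℚ≥0) : ℝ≥0)) →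
      Multiplicative.toAdd (PrimeCoord.coordGp PiNNRat.isPerfFactorial 𝔮' (PiNNRat.chart 𝔮') β) =
        (κ : ℝ) * cv s (PiNNRat.jdx 𝔮')) :
    (hA v : ℝ) + (hB v : ℝ) * goldenRatio = s := by
  classical
  obtain ⟨κ, hκ0, hκ⟩ := PiNNRat.exists_coord_eq_mul_eval (𝔮c v) (PiNNRat.chart (𝔮c v))
  have h1 := h (𝔮c v) κ hκ
  rw [toAdd_coordGp_β _ _ hκ, show PiNNRat.jdx (𝔮c v) = Sum.inl v from PiNNRat.jdx_congr_primeOf _] at h1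
  simp only [cβ, cv, Sum.elim_inl] at h1
  exact mul_left_cancel₀ (NNReal.coe_ne_zero.mpr hκ0) h1

/-- **`β ∉ ℝ·Φ₀^cnst(Y₀)`**: its normalised coordinates at the components `(0,0)` and `(1,0)` differ
(`hA + φ·hB` is not constant). [cite: MochizukiEtTh2009, Prop 3.4 (ii) p.74] -/
theorem β_not_mem : β ∉ ((RealifiedDivisorMonoids.realData dm hpf).realSpan dm.cnstGp).carrier Y₀ := by
  intro hβ
  obtain ⟨s, hs⟩ := exists_const_coord_of_mem_realSpan_cnstGp hβ
  exact toReal_Psi_zero_ne ((eq_of_coord_β_eq s (0, 0) hs).trans (eq_of_coord_β_eq s (1, 0) hs).symm)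

/-! ### The statements refuted -/

/-- **At `Y₀` the `Λ = ℝ` effective-locus clause `hE` FAILS for the tree data** — although the law (L), `Prop34`,
`Prop34Cnst₀` hold and every prime is a `ℚ`-prime: `β ∈ ℝ·Φ₀^birat(Y₀)` is effective and not in `ℝ·Φ₀^cnst(Y₀)`.
[cite: MochizukiEtTh2009, Prop 3.4 (ii) p.74] -/
theorem not_eff :
    ¬ ∀ (b : Algebra.GrothendieckGroup ((RealifiedDivisorMonoids.realData dm hpf).rlf.obj (op Y₀)))
        (x : (hpf (op Y₀)).Rlf),
        b ∈ ((RealifiedDivisorMonoids.realData dm hpf).realSpan dm.biratGp).carrier Y₀ →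
        b = Algebra.GrothendieckGroup.of x →
        b ∈ ((RealifiedDivisorMonoids.realData dm hpf).realSpan dm.cnstGp).carrier Y₀ := by
  intro h
  obtain ⟨y, hy⟩ := β_effective
  exact β_not_mem (h β y β_mem hy)

/-- **`Prop34Cnst (ofRlfR dm hpf) (𝟭 _)` FAILS at the tree model** (its first clause is `hE` at every object), although
`dm.Prop34` and `dm.Prop34Cnst₀ (𝟭 _)` hold. [cite: MochizukiEtTh2009, Prop 3.4 (ii) p.74] -/
theorem not_prop34Cnst_ofRlfR :
    ¬ (RealifiedDivisorMonoids.ofRlfR dm hpf).Prop34Cnst (𝟭 (Discrete PUnit.{1})) :=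
  fun h => not_eff (RealifiedDivisorMonoids.Prop34Cnst.eff_of_prop34Cnst_ofRlfR h Y₀)

/-- **The law (L) does not decide `hE`.**  The chain data (p437249) and the tree data are built from the SAME recipe
— primes `=` vertices ⊔ cusps of a dual graph, `Φ₀ = ∏ ℚ_{≥0}`, `B₀ =` all integer component-order functions with
`div φ = (φ, −Δφ)`, `F₀ =` constants — and both satisfy `Prop34` and `Prop34Cnst₀`; `Prop34Cnst (ofRlfR · ·) (𝟭 _)`
(whose clause 1 is `hE`) HOLDS on the chain `ℤ` (Liouville) and FAILS on the tree `T₃` (transient).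
[cite: MochizukiEtTh2009, Prop 3.4 (ii) p.74] -/
theorem law_L_does_not_decide_hE :
    (RealifiedDivisorMonoids.ofRlfR Sec3Prop34CnstOfRlfRChainModel.dm Sec3Prop34CnstOfRlfRChainModel.hpf).Prop34Cnst
        (𝟭 (Discrete PUnit.{1})) ∧
      ¬ (RealifiedDivisorMonoids.ofRlfR dm hpf).Prop34Cnst (𝟭 (Discrete PUnit.{1})) :=
  ⟨Sec3Prop34CnstOfRlfRChainModel.prop34Cnst_ofRlfR, not_prop34Cnst_ofRlfR⟩

end Sec3Prop34CnstOfRlfRTreeModel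

end Literature.AnabelianGeometry.EtaleTheta

end
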